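import Summits.BirchSwinnertonDyer.BirchSwinnertonDyer.Theorems.EisensteinPrimesSymbolLineRigidity
import Mathlib.NumberTheory.Multiplicity
import Mathlib.NumberTheory.Padics.RingHoms
import HarnessLib

/-!
# The WEIGHT-RESIDUE law behind the `ρ = 2` pencil: `((1+p)^n − 1)/p ≡ n (mod p)`, so a β-branch
# `Φ₀ = p·Ψ + T·Ξ` specialises at weight `k = n + 2` to `p·(Ψ_k + t·Ξ_k)` with `t ≡ n (mod p)`, the
# member's mod-`p` symbol is `Ψ̄ + n̄·Ξ̄`, and `λ` of the member depends on `k mod p` ONLY, generic off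
# at most one residue (cell `bsd-eis`, seat `bsd-line-x2-p2`, D-0154 KEY row 5; route `EisensteinPrimes`,
# crux 4 `BSDpOnCellC` stmt-BirchSwinnertonDyer-19034 line b1 v10 / crux 3 `MazurMCOnCellB`; companion of
# `EisensteinPrimesSymbolLineRigidity` (p606630); memo `HOME/cgshw-MEMO-24.md` §1 (b)(iii) CLAIMS 1–2 and the
# «`λ(g_k) = λ_j`, `j = (k − 2) mod 3`» prediction)

HONEST FRAMING (cell `bsd-eis`, run/shared/lean/pub/bsd-eis/): elementary arithmetic, module algebra and
the tree's `μ`/`λ`/`red` of `Λ = ℤ_p⟦T⟧`, everything PROVED; NO Λ-adic modular symbol, Hida family or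
`L`-function is constructed or asserted; nothing is booked; X2 stays CONSTRUCTION-SHAPED; no label or count
moves; BSD and Mazur's main conjecture are proved for no curve.

## The point

MEMO-24 §1 (b)(iii) explains the `λ`-jump at 1020e1 / 660c1 by a β-branch: the branch's Λ-adic symbol is
`Φ₀ = 3Ψ + sΞ` (`s` the weight variable), the even weight `k` is the point `s ↦ s_k = 4^{k−2} − 1`, so
`Φ₀(x_k) = 3·[Ψ(x_k) + (s_k/3)·Ξ(x_k)]` with `s_k/3 ≡ k − 2 (mod 3)`, the member's primitive mod-3 symbol is
`Ψ̄ + (k−2)·Ξ̄`, and `λ(g_k) = ord_T L̄(Ψ̄ + jΞ̄)`, `j = (k − 2) mod 3`. The ARITHMETIC of this («the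
residue is `k − 2`») and its CONSEQUENCE for `λ` («a function of `k mod p`, minimal off at most one
residue class») are kernel statements for every prime `p` and topological generator `1 + p`; the
modular input («the member's symbol IS the reduction of the bracket», Greenberg–Stevens (6.1) + the
β-type clause `Φ₀ ∈ 𝔪_Λ𝕎`) stays a hypothesis on abstract data, exactly as in the companion file.

* §1 `sq_dvd_one_add_pow_sub_one_sub_mul` — `p² ∣ (1+p)^n − 1 − n·p` in any commutative ring (Mathlib's
  `sq_dvd_add_pow_sub_sub` at `x = 1`); `exists_one_add_pow_sub_one_eq_mul_and_dvd_sub` — in a domain,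
  `(1+p)^n − 1 = p·t` with `p ∣ t − n`; `residue_weightQuotient_eq_natCast` — in `ℤ_p`, `t mod p = n̄`.
* §2 `smul_add_smul_eq_smul_bracket` — `p·Ψ + (p t)·Ξ = p·(Ψ + t·Ξ)` in any module;
  `semilinear_bracket_eq_pencil` — under a `residue`-semilinear reduction `M → K` the bracket reduces to
  the PENCIL member `Ψ̄ + n̄·Ξ̄` (MEMO-24 CLAIM: «`φ̄_{g_k}^{prim} = Ψ̄ + (k−2)·Ξ̄`», IF the member's
  symbol is that bracket — not asserted).
* §3 `lam_eq_lam_of_natCast_eq` — if `red (L n) = A + n̄·B ≠ 0` then `λ(L n)` depends on `n̄ ∈ 𝔽_p`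
  only; `lam_eq_lam_of_modEq` — … i.e. on `n mod p` only; `min_lam_le_lam_of_natCast_ne` — and for
  `n̄₁ ≠ n̄₂` the minimum of `λ(L n₁), λ(L n₂)` bounds every `λ(L n)` from below (generic value off at
  most one residue class: the shape «`λ = 4 ⟺ k ≡ 2 (mod 3)`, else `2`» of the 1020e1 table).

What this is NOT: not a construction of any Hida family, Λ-adic symbol or member; the decomposition
`Φ₀ = pΨ + TΞ`, the specialisation rule `T ↦ (1+p)^{k−2} − 1`, the interpolation `red L = MT(symbol)`
and the non-vanishing are INPUTS; not a proof of `lcongr`, of any main conjecture, or of BSD.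

References: [GreenbergStevens1993] Prop. (6.1), p. 438 (specialisation of Λ-adic symbols); [Washington1997]
§7.1–§7.2 (`Λ`, the weight variable `T ↦ u^s − 1`); [EmertonPollackWeston2006] §3 (variation of `λ` in a
Hida family — the printed Gorenstein / rank-one case); [GreenbergVatsal2000] p. 2–3, (1)–(2).
-/

set_option autoImplicit false
set_option linter.dupNamespace false

noncomputable section

open Literature.NumberTheory.EllipticCurves Summit.BirchSwinnertonDyer.Rank1Residual.X1.MuLambda
  Summit.BirchSwinnertonDyer.Rank1Residual.Supersingular
  Summit.BirchSwinnertonDyer.BirchSwinnertonDyer.Theorems.SymbolLineRigidity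

namespace Summit.BirchSwinnertonDyer.BirchSwinnertonDyer.Theorems.WeightResiduePencil

/-! ## §1. Arithmetic of the weight variable: `((1+p)^n − 1)/p ≡ n (mod p)` -/

section Arithmetic

/-- **`p² ∣ (1+p)^n − 1 − n·p`** in any commutative ring (binomial theorem; Mathlib's
`sq_dvd_add_pow_sub_sub` at `x = 1`). [folklore] -/
theorem sq_dvd_one_add_pow_sub_one_sub_mul {R : Type*} [CommRing R] (p : R) (n : ℕ) :
    p ^ 2 ∣ (1 + p) ^ n - 1 - (n : R) * p := by
  have h := sq_dvd_add_pow_sub_sub p 1 n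
  have e : (1 + p) ^ n - 1 ^ (n - 1) * p * (n : R) - 1 ^ n = (1 + p) ^ n - 1 - (n : R) * p := by
    rw [one_pow, one_pow]; ring
  rwa [e] at h

/-- **The weight quotient.** In a domain, for `p ≠ 0`: `(1+p)^n − 1 = p·t` for a (unique) `t`, and
`p ∣ t − n` — i.e. `((1+p)^n − 1)/p ≡ n (mod p)`; at `p = 3`, `1 + p = 4`: `(4^{k−2} − 1)/3 ≡ k − 2 (mod 3)`
(MEMO-24 §1 NOTATION: «`s_k/3 ≡ k − 2 (mod 3)`»). [folklore] -/
theorem exists_one_add_pow_sub_one_eq_mul_and_dvd_sub {R : Type*} [CommRing R] [IsDomain R] {p : R}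
    (hp : p ≠ 0) (n : ℕ) : ∃ t : R, (1 + p) ^ n - 1 = p * t ∧ p ∣ t - n := by
  obtain ⟨t, ht⟩ : p ∣ (1 + p) ^ n - 1 := by
    simpa using sub_dvd_pow_sub_pow (1 + p) (1 : R) n
  refine ⟨t, ht, ?_⟩
  have h2 : p ^ 2 ∣ p * (t - n) := by
    have e : p * (t - (n : R)) = (1 + p) ^ n - 1 - (n : R) * p := by rw [mul_sub, ← ht]; ring
    rw [e]
    exact sq_dvd_one_add_pow_sub_one_sub_mul p n
  rw [pow_two] at h2
  exact (mul_dvd_mul_iff_left hp).mp h2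

/-- The weight quotient is unique (cancellation). [folklore] -/
theorem weightQuotient_unique {R : Type*} [CommRing R] [IsDomain R] {p : R} (hp : p ≠ 0) (n : ℕ)
    {t t' : R} (ht : (1 + p) ^ n - 1 = p * t) (ht' : (1 + p) ^ n - 1 = p * t') : t = t' :=
  mul_left_cancel₀ hp (ht.symm.trans ht')

variable {p : ℕ} [Fact p.Prime]

/-- **In `ℤ_p`: the weight quotient reduces to `n̄`.** If `(1+p)^n − 1 = p·t` in `ℤ_p` then
`t mod p = n` in the residue field. [folklore] -/
theorem residue_weightQuotient_eq_natCast (n : ℕ) {t : ℤ_[p]}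
    (ht : (1 + (p : ℤ_[p])) ^ n - 1 = (p : ℤ_[p]) * t) :
    IsLocalRing.residue ℤ_[p] t = (n : IsLocalRing.ResidueField ℤ_[p]) := by
  have hp : (p : ℤ_[p]) ≠ 0 := by exact_mod_cast (Fact.out : p.Prime).ne_zero
  obtain ⟨t', ht', hdvd⟩ := exists_one_add_pow_sub_one_eq_mul_and_dvd_sub hp n
  have htt : t = t' := weightQuotient_unique hp n ht ht'
  subst htt
  rw [← map_natCast (IsLocalRing.residue ℤ_[p]) n, ← sub_eq_zero, ← map_sub,
    IsLocalRing.residue_eq_zero_iff, PadicInt.maximalIdeal_eq_span_p, Ideal.mem_span_singleton]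
  exact hdvd

/-- **The weight point of `ℤ_p`**: `(1+p)^n − 1 = p·t` with `t mod p = n̄` (existence + residue).
[folklore] -/
theorem exists_weightQuotient (n : ℕ) :
    ∃ t : ℤ_[p], (1 + (p : ℤ_[p])) ^ n - 1 = (p : ℤ_[p]) * t ∧
      IsLocalRing.residue ℤ_[p] t = (n : IsLocalRing.ResidueField ℤ_[p]) := by
  have hp : (p : ℤ_[p]) ≠ 0 := by exact_mod_cast (Fact.out : p.Prime).ne_zero
  obtain ⟨t, ht, -⟩ := exists_one_add_pow_sub_one_eq_mul_and_dvd_sub hp n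
  exact ⟨t, ht, residue_weightQuotient_eq_natCast n ht⟩

end Arithmetic

/-! ## §2. The bracket: `p·Ψ + (p t)·Ξ = p·(Ψ + t·Ξ)` and its reduction `Ψ̄ + n̄·Ξ̄` -/

section Bracket

variable {p : ℕ} [Fact p.Prime]

/-- **The bracket identity** (MEMO-24 §1 (b)(iii): «`Φ₀(x_k) = 3·[Ψ(x_k) + (s_k/3)Ξ(x_k)]`»): in any
module, `p·Ψ + s·Ξ = p·(Ψ + t·Ξ)` when `s = p·t`. [folklore] -/
theorem smul_add_smul_eq_smul_bracket {R M : Type*} [CommRing R] [AddCommGroup M] [Module R M]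
    {q s t : R} (hs : s = q * t) (Ψ Ξ : M) : q • Ψ + s • Ξ = q • (Ψ + t • Ξ) := by
  rw [hs, smul_add, mul_smul]

variable {M : Type*} [AddCommGroup M] [Module ℤ_[p] M]
  {K : Type*} [AddCommGroup K] [Module (IsLocalRing.ResidueField ℤ_[p]) K]
  (rbar : M →ₛₗ[IsLocalRing.residue ℤ_[p]] K)

/-- **The member's mod-`p` symbol is a PENCIL member** (MEMO-24 §1 (b)(iii) CLAIM: «mod 3 the bracket is
`Ψ̄ + (k−2)·Ξ̄`»), kernel form: for a `residue`-semilinear reduction `rbar : M → K` and the weight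
quotient `t` of `n = k − 2` (`(1+p)^n − 1 = p·t`), `rbar (Ψ + t·Ξ) = rbar Ψ + n̄·rbar Ξ`. The modular
content (that the member's primitive symbol IS this bracket) is NOT asserted. [cite: GreenbergStevens1993,
Prop. (6.1), p. 438 (specialisation of Λ-adic symbols; the β-type decomposition is beyond print)] -/
theorem semilinear_bracket_eq_pencil (n : ℕ) {t : ℤ_[p]}
    (ht : (1 + (p : ℤ_[p])) ^ n - 1 = (p : ℤ_[p]) * t) (Ψ Ξ : M) :
    rbar (Ψ + t • Ξ) = rbar Ψ + (n : IsLocalRing.ResidueField ℤ_[p]) • rbar Ξ := by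
  rw [map_add, LinearMap.map_smulₛₗ, residue_weightQuotient_eq_natCast n ht]

/-- **Specialisation + reduction in one line**: if the weight-`k` specialisation of the branch symbol is
`Φk = p·Ψk + s·Ξk` with `s = (1+p)^n − 1` (`n = k − 2`), then `Φk = p·(Ψk + t·Ξk)` for the weight
quotient `t`, and the bracket reduces to `Ψ̄ + n̄·Ξ̄`. [cite: GreenbergStevens1993, Prop. (6.1), p. 438] -/
theorem specialisation_bracket (n : ℕ) {Φk Ψk Ξk : M}
    (hΦ : Φk = (p : ℤ_[p]) • Ψk + ((1 + (p : ℤ_[p])) ^ n - 1) • Ξk) :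
    ∃ t : ℤ_[p], Φk = (p : ℤ_[p]) • (Ψk + t • Ξk) ∧
      rbar (Ψk + t • Ξk) = rbar Ψk + (n : IsLocalRing.ResidueField ℤ_[p]) • rbar Ξk := by
  obtain ⟨t, ht, -⟩ := exists_weightQuotient (p := p) n
  exact ⟨t, by rw [hΦ, smul_add_smul_eq_smul_bracket ht], semilinear_bracket_eq_pencil rbar n ht Ψk Ξk⟩

end Bracket

/-! ## §3. `λ` of the weight-`k` member is a function of `k mod p`, generic off one residue class -/

section LambdaByResidue

variable {p : ℕ} [Fact p.Prime] (L : ℕ → IwasawaAlgebra p)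
  (A B : PowerSeries (IsLocalRing.ResidueField ℤ_[p]))

/-- `λ(L n) = ord_T(A + n̄·B)` in `ℕ∞` when `red (L n) = A + n̄·B ≠ 0` (the tree's
`Supersingular.mu_eq_zero_and_lam_eq_of_red_ne_zero`). [cite: GreenbergVatsal2000, p. 2–3, (1)–(2)] -/
theorem lam_eq_order_pencil (n : ℕ)
    (hred : red (L n) = A + (n : IsLocalRing.ResidueField ℤ_[p]) • B)
    (hne : A + (n : IsLocalRing.ResidueField ℤ_[p]) • B ≠ 0) :
    mu (L n) = 0 ∧ (lam (L n) : ℕ∞) = (A + (n : IsLocalRing.ResidueField ℤ_[p]) • B).order := by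
  have h := mu_eq_zero_and_lam_eq_of_red_ne_zero (g := L n) (by rw [hred]; exact hne)
  rw [hred] at h
  exact h

/-- **`λ` depends on `n̄` only.** If `red (L n) = A + n̄·B` and `red (L m) = A + m̄·B` are non-zero and
`n̄ = m̄` in `𝔽_p`, then `λ(L n) = λ(L m)` (MEMO-24 §1 (b)(iii): «λ of the weight-`k` member depends
only on `k mod 3`»). [cite: GreenbergStevens1993, Prop. (6.1), p. 438] -/
theorem lam_eq_lam_of_natCast_eq {n m : ℕ}
    (hn : red (L n) = A + (n : IsLocalRing.ResidueField ℤ_[p]) • B)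
    (hm : red (L m) = A + (m : IsLocalRing.ResidueField ℤ_[p]) • B)
    (hn0 : A + (n : IsLocalRing.ResidueField ℤ_[p]) • B ≠ 0)
    (hnm : (n : IsLocalRing.ResidueField ℤ_[p]) = (m : IsLocalRing.ResidueField ℤ_[p])) :
    lam (L n) = lam (L m) := by
  have hm0 : A + (m : IsLocalRing.ResidueField ℤ_[p]) • B ≠ 0 := by rw [← hnm]; exact hn0
  have h1 := (lam_eq_order_pencil L A B n hn hn0).2
  have h2 := (lam_eq_order_pencil L A B m hm hm0).2
  rw [hnm] at h1
  exact_mod_cast h1.trans h2.symm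

/-- **… i.e. on `n mod p` only** (`n ≡ m (mod p)` ⇒ `n̄ = m̄` in the residue field of `ℤ_p`, of
characteristic `p`). [cite: GreenbergStevens1993, Prop. (6.1), p. 438] -/
theorem lam_eq_lam_of_modEq {n m : ℕ}
    (hn : red (L n) = A + (n : IsLocalRing.ResidueField ℤ_[p]) • B)
    (hm : red (L m) = A + (m : IsLocalRing.ResidueField ℤ_[p]) • B)
    (hn0 : A + (n : IsLocalRing.ResidueField ℤ_[p]) • B ≠ 0) (hnm : n ≡ m [MOD p]) :
    lam (L n) = lam (L m) := by
  haveI : CharP (IsLocalRing.ResidueField ℤ_[p]) p :=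
    charP_of_injective_ringHom (f := ((PadicInt.residueField (p := p)).symm : ZMod p →+* _))
      (PadicInt.residueField (p := p)).symm.injective p
  exact lam_eq_lam_of_natCast_eq L A B hn hm hn0
    ((CharP.natCast_eq_natCast (IsLocalRing.ResidueField ℤ_[p]) p).mpr hnm)

/-- **Generic off at most one residue class.** If `red (L n) = A + n̄·B ≠ 0` for `n ∈ {n₁, n₂, m}` with
`n̄₁ ≠ n̄₂`, then `min (λ(L n₁)) (λ(L n₂)) ≤ λ(L m)`: no residue class lies strictly below two others, so
all classes but at most one carry the minimal `λ` (the shape «`λ = 4 ⟺ k ≡ 2 (mod 3)`, else `2`» at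
1020e1; «`λ = 4 ⟺ k ≡ 1`, else `2`» at 660c1). [cite: GreenbergStevens1993, Prop. (6.1), p. 438] -/
theorem min_lam_le_lam_of_natCast_ne {n₁ n₂ m : ℕ}
    (h₁ : red (L n₁) = A + (n₁ : IsLocalRing.ResidueField ℤ_[p]) • B)
    (h₂ : red (L n₂) = A + (n₂ : IsLocalRing.ResidueField ℤ_[p]) • B)
    (hm : red (L m) = A + (m : IsLocalRing.ResidueField ℤ_[p]) • B)
    (h₁0 : A + (n₁ : IsLocalRing.ResidueField ℤ_[p]) • B ≠ 0)
    (h₂0 : A + (n₂ : IsLocalRing.ResidueField ℤ_[p]) • B ≠ 0)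
    (hm0 : A + (m : IsLocalRing.ResidueField ℤ_[p]) • B ≠ 0)
    (hne : (n₁ : IsLocalRing.ResidueField ℤ_[p]) ≠ (n₂ : IsLocalRing.ResidueField ℤ_[p])) :
    min (lam (L n₁)) (lam (L n₂)) ≤ lam (L m) := by
  have e₁ := (lam_eq_order_pencil L A B n₁ h₁ h₁0).2
  have e₂ := (lam_eq_order_pencil L A B n₂ h₂ h₂0).2
  have eₘ := (lam_eq_order_pencil L A B m hm hm0).2
  have h := min_order_pencil_le_order_pencil A B hne (m : IsLocalRing.ResidueField ℤ_[p])
  rw [← e₁, ← e₂, ← eₘ] at h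
  rcases le_total (lam (L n₁)) (lam (L n₂)) with hle | hle
  · rw [min_eq_left hle]
    rw [min_eq_left (ENat.coe_le_coe.mpr hle)] at h
    exact ENat.coe_le_coe.mp h
  · rw [min_eq_right hle]
    rw [min_eq_right (ENat.coe_le_coe.mpr hle)] at h
    exact ENat.coe_le_coe.mp h

/-- **A jump between two residue classes forces two independent mod-`p` `L`-functions** («`ρ ≥ 2` is
NECESSARY for (F-D)», MEMO-24 §1 (c)): if `red (L n₁) = A + n̄₁·B` and `red (L n₂) = A + n̄₂·B` are
non-zero with `λ(L n₁) ≠ λ(L n₂)`, then `A = L̄(Ψ̄)` and `B = L̄(Ξ̄)` are linearly independent over `𝔽_p`.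
[cite: GreenbergStevens1993, Prop. (6.1), p. 438] -/
theorem linearIndependent_of_lam_ne {n₁ n₂ : ℕ}
    (h₁ : red (L n₁) = A + (n₁ : IsLocalRing.ResidueField ℤ_[p]) • B)
    (h₂ : red (L n₂) = A + (n₂ : IsLocalRing.ResidueField ℤ_[p]) • B)
    (h₁0 : A + (n₁ : IsLocalRing.ResidueField ℤ_[p]) • B ≠ 0)
    (h₂0 : A + (n₂ : IsLocalRing.ResidueField ℤ_[p]) • B ≠ 0) (hne : lam (L n₁) ≠ lam (L n₂)) :
    LinearIndependent (IsLocalRing.ResidueField ℤ_[p]) ![A, B] := by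
  refine linearIndependent_of_order_pencil_ne h₁0 h₂0 ?_
  have e₁ := (lam_eq_order_pencil L A B n₁ h₁ h₁0).2
  have e₂ := (lam_eq_order_pencil L A B n₂ h₂ h₂0).2
  rw [← e₁, ← e₂]
  exact_mod_cast hne

end LambdaByResidue

end Summit.BirchSwinnertonDyer.BirchSwinnertonDyer.Theorems.WeightResiduePencil

end
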